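import Summits.BirchSwinnertonDyer.BirchSwinnertonDyer.Theorems.QuadraticBranchSignedControlPlusEtaNonsurjCMSqrtKummer
import Summits.BirchSwinnertonDyer.BirchSwinnertonDyer.Theorems.QuadraticBranchSignedControlPlusEtaNonsurjCartanFieldCMTwist
import Summits.BirchSwinnertonDyer.BirchSwinnertonDyer.Theorems.QuadraticBranchSignedControlPlusEtaNonsurjCartanFieldFixedField
import Mathlib.FieldTheory.Galois.Infinite
import HarnessLib

/-!
# Route `QuadraticBranchSignedControl` (rung K8, cell `bsd-potss`): crux stmt-BirchSwinnertonDyer-19606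
# `PlusEtaMainConjectureNonsurj` — A CM ANCHOR FORCES THE CARTAN FIELD TO BE ITS CM FIELD `ℚ(√d_K)`, ONE OF THE NINE
# CLASS-NUMBER-ONE FIELDS (FINDING-19606-k8eta-c2-g5 §2 (c), g13 successor item (3)(e) — kernel form, hypothesis-free)

WHAT. k8eta-c2 g9/g10 proved: a CM-curve anchor `A` of a row `V` of crux 19606 (`V[p] ≅ A[p]`) forces `H_V = ker χ`, `χ` the
abstract quadratic character twisting a visible `√D` on `A` (`…CartanFieldCMTwist`), and `K_V` exists as a quadratic subfield of
`ℚ̄` with `Gal(ℚ̄/K_V) = H_V` (`…CartanFieldFixedField`). The sibling `…CMSqrtKummer` (this seat) identifies `χ` on `√d_K ∈ ℚ̄`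
(`exists_visible_sqrt_twist_kummer_of_hasCM`: `χ(σ) = 1 ⟺ σ√d_K = √d_K`, `d_K = cmFieldDiscrOfJ (j A)`). Hence here:

* `centralizes_sq_iff_smul_geomSqrt_of_cmAnchor_of_row`: **`σ ∈ H_V ⟺ σ√d_K = √d_K`** — the Cartan subgroup of a CM-anchored
  row is the stabiliser of `√d_K`;
* `cartanField_eq_adjoin_geomSqrt_of_cmAnchor_of_row` / `exists_cartanField_eq_adjoin_geomSqrt_of_cmAnchor_of_row`: **`K_V = ℚ(√d_K)`
  inside `ℚ̄`, `d_K ∈ {−3, −4, −7, −8, −11, −19, −43, −67, −163}`** (Galois correspondence for `ℚ̄/ℚ`,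
  `InfiniteGalois.fixedField_fixingSubgroup`); with `…CartanFieldInert` `p` is inert in it (at `p = 5`: `d_K ∈ {−3, −7, −8, −43,
  −67, −163}`, g5's list, now by structure);
* `not_exists_cmAnchor_of_forall_nine`: the KERNEL DOOR of the v7 stub `stub_etaMC_nonCM_uncongruent` — nine Galois elements on
  which «`σ ∈ H_V`» and «`σ` fixes `√d`» disagree (one per discriminant) certify the negated existential «no globally minimal CM
  curve, good at `p` with `a_p = 0`, is mod-`p` congruent to `V`» VERBATIM (g5 census at `p = 5`, height ≤ 20: 304/336
  `X_ns⁺(5)` rows have `h(K_V) > 1`, hence qualify).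

HONEST FRAMING (cell `bsd-potss`, run/shared/lean/pub/bsd-potss/; FULL-BSD rank ≤ 1 programme): TOOL THEOREMS ONLY (no definition,
no named fact, no `sorry`, axioms standard). Nothing is booked; crux 19606 stays OPEN (the uncongruent stub is class-wide open);
`BSD(W, p)` is claimed for no pair. Seat `bsd-potss-k8eta-c2` g14 (prover), `--supports stmt-BirchSwinnertonDyer-19606`.

References: [Lang1987] Ch. 10 §4 (Remark, Thm. 8); [Serre1972] §2.2, §4.5; [Zywina2015] Thm. 1.4 (`X_ns⁺(5)`);
[SilvermanAdvancedTopics1994] Thm. II.2.2(a), App. A §3.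
-/

set_option autoImplicit false
set_option linter.dupNamespace false

noncomputable section

open scoped Classical

open Field WeierstrassCurve Literature.NumberTheory.EllipticCurves Literature.NumberTheory.EllipticCurves.Rank1Residual
  Literature.NumberTheory.SerreUniformity
open Summit.BirchSwinnertonDyer.Rank1Residual.O6 (ModPCongruent)

namespace Summit.BirchSwinnertonDyer.BirchSwinnertonDyer.Theorems.EtaCartanField

/-! ## §4 Rows of crux 19606: a CM anchor forces `K_V = ℚ(√d_K)` -/

section Row

variable (V : WeierstrassCurve ℚ) [V.IsElliptic] [V.IsGloballyMinimal] (p : ℕ) [Fact p.Prime]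

/-- Symmetry of mod-`p` congruence (bookkeeping). [folklore] -/
private theorem modPCongruent_symm' {W W' : WeierstrassCurve ℚ} {q : ℕ} (h : ModPCongruent W W' q) :
    ModPCongruent W' W q := by
  obtain ⟨e, he⟩ := h
  refine ⟨e.symm, fun σ P => e.injective ?_⟩
  rw [e.apply_symm_apply, he, e.apply_symm_apply]

/-- **A CM anchor pins the Cartan subgroup to the stabiliser of `√d_K`.** Let `V/ℚ` be a row of crux 19606 (globally minimal,
`p ≥ 5` good, `a_p = 0`, `p`-adic tower not onto) and `A/ℚ` an elliptic curve WITH CM which is mod-`p` congruent to `V`.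
Then for every `σ ∈ Γ_ℚ`: `σ` centralises the squares on `V[p]` (i.e. `σ ∈ H_V = ρ̄⁻¹(C_ns(p))`) **iff `σ` fixes
`√d_K ∈ ℚ̄`**, `d_K = cmFieldDiscrOfJ (j A) ∈ {−3, −4, −7, −8, −11, −19, −43, −67, −163}`. (g10's
`centralizes_sq_iff_twistChar_eq_one_of_cmAnchor_of_row` fed with `exists_visible_sqrt_twist_kummer_of_hasCM`.)
[cite: Lang1987, Ch. 10 §4, Remark] [cite: Serre1972, §4.5] -/
theorem centralizes_sq_iff_smul_geomSqrt_of_cmAnchor_of_row (hp5 : 5 ≤ p) (hgood : V.HasGoodReductionAtPrime p)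
    (hap : V.frobeniusTrace p = 0) (hns : ¬ ∀ m : ℕ, V.HasSurjectiveModNGaloisRep (p ^ m : ℕ))
    {A : WeierstrassCurve ℚ} [A.IsElliptic] (hCM : A.HasCM) (hVA : ModPCongruent V A p) (σ : absoluteGaloisGroup ℚ) :
    (∀ (τ : absoluteGaloisGroup ℚ) (P : V.geomTorsion p), σ • ((τ * τ) • P) = (τ * τ) • (σ • P)) ↔
      σ • geomSqrt ((cmFieldDiscrOfJ A.j : ℤ) : ℚ) = geomSqrt ((cmFieldDiscrOfJ A.j : ℤ) : ℚ) := by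
  obtain ⟨ψ, D, χ, -, hψψ, hχ, hrel, hvis, hiff⟩ :=
    exists_visible_sqrt_twist_kummer_of_hasCM A hCM (Fact.out : p.Prime)
  rw [← hiff σ]
  exact centralizes_sq_iff_twistChar_eq_one_of_cmAnchor_of_row V p hp5 hgood hap hns hVA hψψ hχ hrel hvis σ

/-- **The Cartan field of a CM-anchored row IS the CM field `ℚ(√d_K)`.** With `V`, `A` as above, every intermediate field
`K ≤ ℚ̄` whose fixing group is `H_V` (the Cartan field `K_V` of `exists_cartanField_of_row`) equals `ℚ(√d_K)`,
`d_K = cmFieldDiscrOfJ (j A)` — by `centralizes_sq_iff_smul_geomSqrt_of_cmAnchor_of_row` and the Galois correspondence for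
`ℚ̄/ℚ` (`InfiniteGalois.fixedField_fixingSubgroup`). [cite: Lang1987, Ch. 10 §4, Remark] [cite: Serre1972, §4.5] -/
theorem cartanField_eq_adjoin_geomSqrt_of_cmAnchor_of_row (hp5 : 5 ≤ p) (hgood : V.HasGoodReductionAtPrime p)
    (hap : V.frobeniusTrace p = 0) (hns : ¬ ∀ m : ℕ, V.HasSurjectiveModNGaloisRep (p ^ m : ℕ))
    {A : WeierstrassCurve ℚ} [A.IsElliptic] (hCM : A.HasCM) (hVA : ModPCongruent V A p)
    {K : IntermediateField ℚ (AlgebraicClosure ℚ)}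
    (hK : ∀ σ : absoluteGaloisGroup ℚ, σ ∈ K.fixingSubgroup ↔
      ∀ (τ : absoluteGaloisGroup ℚ) (P : V.geomTorsion p), σ • ((τ * τ) • P) = (τ * τ) • (σ • P)) :
    K = IntermediateField.adjoin ℚ {geomSqrt ((cmFieldDiscrOfJ A.j : ℤ) : ℚ)} := by
  haveI : Algebra.IsAlgebraic ℚ (AlgebraicClosure ℚ) := AlgebraicClosure.isAlgebraic ℚ
  haveI : IsAlgClosure ℚ (AlgebraicClosure ℚ) := ⟨inferInstance, inferInstance⟩
  haveI : IsGalois ℚ (AlgebraicClosure ℚ) := IsGalois.mk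
  set θ : AlgebraicClosure ℚ := geomSqrt ((cmFieldDiscrOfJ A.j : ℤ) : ℚ) with hθ
  set L : IntermediateField ℚ (AlgebraicClosure ℚ) := IntermediateField.adjoin ℚ {θ} with hL
  set S : Subgroup (AlgebraicClosure ℚ ≃ₐ[ℚ] AlgebraicClosure ℚ) :=
    MulAction.stabilizer (AlgebraicClosure ℚ ≃ₐ[ℚ] AlgebraicClosure ℚ) θ with hS
  have hLS : L ≤ IntermediateField.fixedField S := by
    rw [hL, IntermediateField.adjoin_simple_le_iff, IntermediateField.mem_fixedField_iff S θ]
    intro g hg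
    exact MulAction.mem_stabilizer_iff.mp hg
  have hfix : K.fixingSubgroup = L.fixingSubgroup := by
    refine Subgroup.ext fun σ => (hK σ).trans
      ((centralizes_sq_iff_smul_geomSqrt_of_cmAnchor_of_row V p hp5 hgood hap hns hCM hVA σ).trans ?_)
    rw [IntermediateField.mem_fixingSubgroup_iff]
    constructor
    · intro hσ x hx
      have hσS : σ ∈ S := MulAction.mem_stabilizer_iff.mpr hσ
      exact (IntermediateField.mem_fixedField_iff S x).mp (hLS hx) σ hσS
    · intro hσ
      exact hσ θ (IntermediateField.mem_adjoin_simple_self ℚ θ)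
  rw [← InfiniteGalois.fixedField_fixingSubgroup K, hfix, InfiniteGalois.fixedField_fixingSubgroup]

/-- **CM anchor ⟹ `K_V = ℚ(√d_K)` with `d_K` one of the nine class-number-one discriminants** (FINDING-19606-k8eta-c2-g5
§2 (c) / g13 successor item (3)(e), kernel form): on every row `V` of crux 19606 with a CM-curve anchor `A` (`A.HasCM`,
`V[p] ≅ A[p]`), the Cartan field `K_V` — the quadratic field with `Gal(ℚ̄/K_V) = H_V` — exists, equals `ℚ(√d_K(A))` inside
`ℚ̄`, and `d_K(A) ∈ {−3, −4, −7, −8, −11, −19, −43, −67, −163}`. With `…CartanFieldInert`/`…CartanFieldImaginary`: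
`p` is inert in it. Contrapositive: a row whose `K_V` is none of these nine fields has NO CM-curve anchor (the v7 stub
`stub_etaMC_nonCM_uncongruent`; g5 census at `p = 5`: 304/336 `X_ns⁺(5)` rows have `h(K_V) > 1`).
[cite: Lang1987, Ch. 10 §4, Remark] [cite: Serre1972, §2.2 and §4.5] [cite: Zywina2015, Thm. 1.4] -/
theorem exists_cartanField_eq_adjoin_geomSqrt_of_cmAnchor_of_row (hp5 : 5 ≤ p) (hgood : V.HasGoodReductionAtPrime p)
    (hap : V.frobeniusTrace p = 0) (hns : ¬ ∀ m : ℕ, V.HasSurjectiveModNGaloisRep (p ^ m : ℕ))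
    {A : WeierstrassCurve ℚ} [A.IsElliptic] (hCM : A.HasCM) (hVA : ModPCongruent V A p) :
    ∃ K : IntermediateField ℚ (AlgebraicClosure ℚ), Module.finrank ℚ K = 2 ∧
      (∀ σ : absoluteGaloisGroup ℚ, σ ∈ K.fixingSubgroup ↔
        ∀ (τ : absoluteGaloisGroup ℚ) (P : V.geomTorsion p), σ • ((τ * τ) • P) = (τ * τ) • (σ • P)) ∧
      K = IntermediateField.adjoin ℚ {geomSqrt ((cmFieldDiscrOfJ A.j : ℤ) : ℚ)} ∧
      cmFieldDiscrOfJ A.j ∈ ({-3, -4, -7, -8, -11, -19, -43, -67, -163} : Finset ℤ) := by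
  obtain ⟨K, hK2, hK⟩ := exists_cartanField_of_row V p hp5 hgood hap hns
  exact ⟨K, hK2, hK, cartanField_eq_adjoin_geomSqrt_of_cmAnchor_of_row V p hp5 hgood hap hns hCM hVA hK,
    cmFieldDiscrOfJ_mem_nine_of_hasCM A hCM⟩

/-- **Kernel door of the v7 stub `stub_etaMC_nonCM_uncongruent` («no CM row congruent to `V`»).** If for EACH of the nine
discriminants `d` some `σ ∈ Γ_ℚ` lies in `H_V` but moves `√d`, or lies outside `H_V` but fixes `√d` (e.g. a Frobenius
`Frob_ℓ` with `p ∤ a_ℓ(V)` at a prime `ℓ` inert in `ℚ(√d)`), then NO elliptic curve with CM — in particular no globally minimal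
CM curve good at `p` with `a_p = 0` — is mod-`p` congruent to the row `V`: the negated existential in the hypothesis of
`Sig.stub_etaMC_nonCM_uncongruent`, verbatim. [cite: Serre1972, §4.5] [cite: Lang1987, Ch. 10 §4, Remark] -/
theorem not_exists_cmAnchor_of_forall_nine (hp5 : 5 ≤ p) (hgood : V.HasGoodReductionAtPrime p)
    (hap : V.frobeniusTrace p = 0) (hns : ¬ ∀ m : ℕ, V.HasSurjectiveModNGaloisRep (p ^ m : ℕ))
    (h : ∀ d ∈ ({-3, -4, -7, -8, -11, -19, -43, -67, -163} : Finset ℤ), ∃ σ : absoluteGaloisGroup ℚ,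
      ¬ ((∀ (τ : absoluteGaloisGroup ℚ) (P : V.geomTorsion p), σ • ((τ * τ) • P) = (τ * τ) • (σ • P)) ↔
          σ • geomSqrt ((d : ℤ) : ℚ) = geomSqrt ((d : ℤ) : ℚ))) :
    ¬ ∃ (V'' : WeierstrassCurve ℚ) (_ : V''.IsElliptic) (_ : V''.IsGloballyMinimal),
        V''.HasCM ∧ V''.HasGoodReductionAtPrime p ∧ V''.frobeniusTrace p = 0 ∧ ModPCongruent V'' V p := by
  rintro ⟨A, _, _, hCM, -, -, hAV⟩
  obtain ⟨σ, hσ⟩ := h _ (cmFieldDiscrOfJ_mem_nine_of_hasCM A hCM)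
  exact hσ (centralizes_sq_iff_smul_geomSqrt_of_cmAnchor_of_row V p hp5 hgood hap hns hCM (modPCongruent_symm' hAV) σ)

end Row

end Summit.BirchSwinnertonDyer.BirchSwinnertonDyer.Theorems.EtaCartanField

end
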